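import Mathlib
import HarnessLib
import Summits.Langlands.Langlands.Theses.TorsionKudlaMillsonWindow

/-!
# TorsionKudlaMillsonWindow — proof of the support `TorsionTraceFinite` (stmt-Langlands-18922)

`TorsionTraceFinite` (route-Langlands-TorsionKudlaMillsonWindow; the piece named BY NAME as
`stub_torsionTraceFinite` in the registered line `Cruxes/FTraceCongruenceGeneration/Lines/coset_twist.lean`
of the binder `gen : FTraceCongruenceGeneration` of the route's deciding theorem `closes`).

TORSION CONTROL BY TRACES, proved outright.  Fix the window datum `(F, K, σ, a, b)`, the quaternion
algebra `B = (a', b')_K` and its coordinate order `O = O_K⟨1, i, j, k⟩` (`IsG`).  CLAIM: there is a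
finite set `T ⊆ K` containing the real part `re u` of every norm-one unit `u ∈ O^×` of finite order.

PROOF.  Take `T := {x ∈ K : x is an algebraic integer and ‖φ x‖ ≤ 1 for every embedding φ : K → ℂ}`,
finite by Mathlib's `NumberField.Embeddings.finite_of_norm_le` (Northcott for a fixed field).
Let `u ∈ O^×` have reduced norm `u ū = 1` and finite order `n ≥ 1`.
* `re u ∈ O_K` because the coordinates of `u` lie in `O_K` (`IsG`).
* Put `t := 2 re u ∈ K`, so `ū = t − u` and `u² = t u − 1` (Cayley–Hamilton in rank 2).  The two-term
  recursion `u^{m+1} = A_m u + B_m` (`A_0 = 1, B_0 = 0, A_{m+1} = A_m t + B_m, B_{m+1} = −A_m`,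
  `A_m, B_m ∈ K`) holds in `B`, and for every embedding `φ` and every complex root `z` of
  `z² = φ(t) z − 1` the SAME recursion gives `z^{m+1} = φ(A_m) z + φ(B_m)`.  At `m + 1 = n`:
  either `A ≠ 0`, then `u = A⁻¹(1 − B) ∈ K` is a scalar with `u² = 1`, so `u = ±1` and `re u = ±1`;
  or `A = 0`, then `B = 1`, hence `zⁿ = 1`, `‖z‖ = 1`, and `φ(t) = z + z⁻¹` has `‖φ(t)‖ ≤ 2`, i.e.
  `‖φ(re u)‖ ≤ 1`.
Either way `re u ∈ T`.  (The classical argument bounds the order `n` through `φ(n) ≤ 2[K:ℚ]`;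
the complex-root form above needs neither cyclotomic theory nor the division-algebra hypothesis.)
No definition, no named unproved fact as a hypothesis, no `sorry`.
References: Maclachlan–Reid, *The arithmetic of hyperbolic 3-manifolds* (2003), Ch. 12 (torsion in
arithmetic Kleinian groups) [MaclachlanReid2003]; Vignéras, *Arithmétique des algèbres de quaternions*,
LNM 800 (1980), Ch. IV §1 [VignerasLNM800].
-/

set_option linter.dupNamespace false

namespace Summit.Langlands.Langlands.Theorems.TorsionKudlaMillsonWindowTorsionTraceFinite

open NumberField
open Summit.Langlands.Langlands.Theses
open Summit.Langlands.Langlands.Theses.TorsionKudlaMillsonWindow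

/-- **Cayley–Hamilton recursion, run in the quaternion algebra and in `ℂ` in parallel.**
If `x² = t x − 1` in the quaternion algebra `(c₁, 0, c₃)_K` with `t ∈ K`, then for every `m` there are
`A, B ∈ K` with `x^{m+1} = A x + B`, and for every ring map `φ : K → ℂ` and every `z ∈ ℂ` with
`z² = φ(t) z − 1` the same `A, B` give `z^{m+1} = φ(A) z + φ(B)`. [folklore] -/
theorem pow_succ_eq_linear {K : Type*} [Field K] {c₁ c₃ : K}
    (x : QuaternionAlgebra K c₁ 0 c₃) (t : K)
    (hx : x * x = (t : QuaternionAlgebra K c₁ 0 c₃) * x - 1) (m : ℕ) :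
    ∃ A B : K, x ^ (m + 1) = (A : QuaternionAlgebra K c₁ 0 c₃) * x + (B : QuaternionAlgebra K c₁ 0 c₃) ∧
      ∀ (φ : K →+* ℂ) (z : ℂ), z * z = φ t * z - 1 → z ^ (m + 1) = φ A * z + φ B := by
  induction m with
  | zero =>
    refine ⟨1, 0, ?_, ?_⟩
    · simp
    · intro φ z _
      simp
  | succ m ih =>
    obtain ⟨A, B, hQ, hC⟩ := ih
    refine ⟨A * t + B, -A, ?_, ?_⟩
    · calc x ^ (m + 1 + 1) = x ^ (m + 1) * x := pow_succ _ _
        _ = ((A : QuaternionAlgebra K c₁ 0 c₃) * x + (B : QuaternionAlgebra K c₁ 0 c₃)) * x := by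
            rw [hQ]
        _ = (A : QuaternionAlgebra K c₁ 0 c₃) * (x * x) + (B : QuaternionAlgebra K c₁ 0 c₃) * x := by
            rw [add_mul, mul_assoc]
        _ = (A : QuaternionAlgebra K c₁ 0 c₃) * ((t : QuaternionAlgebra K c₁ 0 c₃) * x - 1)
              + (B : QuaternionAlgebra K c₁ 0 c₃) * x := by rw [hx]
        _ = ((A * t + B : K) : QuaternionAlgebra K c₁ 0 c₃) * x
              + ((-A : K) : QuaternionAlgebra K c₁ 0 c₃) := by
            push_cast
            noncomm_ring
    · intro φ z hz
      have h1 : z ^ (m + 1 + 1) = (φ A * z + φ B) * z := by rw [pow_succ, hC φ z hz]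
      rw [h1, map_add, map_mul, map_neg]
      linear_combination (φ A) * hz

/-- **Every complex number `c` admits a root of `z² = c z − 1`.** (Quadratic formula; `ℂ` has square
roots.) [folklore] -/
theorem exists_root_quadratic (c : ℂ) : ∃ z : ℂ, z * z = c * z - 1 := by
  obtain ⟨s, hs⟩ := IsAlgClosed.exists_pow_nat_eq (c ^ 2 - 4) (n := 2) (by norm_num)
  refine ⟨(c + s) / 2, ?_⟩
  linear_combination (1 / 4 : ℂ) * hs

/-- **A complex number of the form `z + z⁻¹` with `zⁿ = 1` (`n ≠ 0`) has norm at most `2`.**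
[folklore] -/
theorem norm_le_two_of_root_of_unity {c z : ℂ} {n : ℕ} (hn : n ≠ 0) (hzn : z ^ n = 1)
    (hz : z * z = c * z - 1) : ‖c‖ ≤ 2 := by
  have hz1 : ‖z‖ = 1 := Complex.norm_eq_one_of_pow_eq_one hzn hn
  have hz0 : z ≠ 0 := by
    intro h
    rw [h, norm_zero] at hz1
    exact zero_ne_one hz1
  have hc : c = z + z⁻¹ := by
    field_simp
    linear_combination -hz
  calc ‖c‖ = ‖z + z⁻¹‖ := by rw [hc]
    _ ≤ ‖z‖ + ‖z⁻¹‖ := norm_add_le _ _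
    _ = 2 := by rw [norm_inv, hz1]; norm_num

/-- **`TorsionTraceFinite` (stmt-Langlands-18922), proved outright.**  The real parts of the
finite-order norm-one units of the coordinate order of `(a', b')_K` lie in the finite set of algebraic
integers of `K` all of whose conjugates have absolute value `≤ 1`.  Maclachlan–Reid 2003 Ch. 12;
Vignéras LNM 800 Ch. IV §1. [folklore] -/
theorem torsionTraceFinite_proof :
    Summit.Langlands.Langlands.Theses.TorsionKudlaMillsonWindow.TorsionTraceFinite := by
  intro F K _ _ _ _ _ σ a b _hF _h2 _hσ _hK _ha _hb _hneg _hpos a' b' _hdiv IsInt IsG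
  classical
  refine ⟨(NumberField.Embeddings.finite_of_norm_le K ℂ (1 : ℝ)).toFinset, ?_⟩
  intro u hG hnorm hfo
  rw [Set.Finite.mem_toFinset]
  -- abbreviations: the quaternion `x := u` and its trace `t := 2 re x`
  obtain ⟨hGu, -⟩ := hG
  have hre : (u : QuaternionAlgebra K a' 0 b').re ∈ Set.range (algebraMap (𝓞 K) K) := by
    simpa [QuaternionAlgebra.equivTuple_apply] using hGu 0
  obtain ⟨r, hr⟩ := hre
  -- (1) integrality of `re u`
  have hint : IsIntegral ℤ (u : QuaternionAlgebra K a' 0 b').re := by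
    rw [← hr]
    exact NumberField.RingOfIntegers.isIntegral_coe r
  refine ⟨hint, ?_⟩
  -- (2) the finite order
  obtain ⟨n, hn, hun⟩ := hfo.exists_pow_eq_one
  have hxn : (u : QuaternionAlgebra K a' 0 b') ^ n = 1 := by
    rw [← Units.val_pow_eq_pow_val, hun, Units.val_one]
  -- (3) Cayley–Hamilton: `star x = t - x` and `x * x = t * x - 1`
  set x : QuaternionAlgebra K a' 0 b' := (u : QuaternionAlgebra K a' 0 b') with hxdef
  set t : K := 2 * x.re with htdef
  have hadd : x + star x = (t : QuaternionAlgebra K a' 0 b') := by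
    have h := QuaternionAlgebra.self_add_star' x
    simpa [htdef] using h
  have hstar : star x = (t : QuaternionAlgebra K a' 0 b') - x := by
    rw [← hadd, add_sub_cancel_left]
  have hmul : (t : QuaternionAlgebra K a' 0 b') * x - x * x = 1 := by
    have h := hnorm
    rw [hstar, mul_sub, ← QuaternionAlgebra.coe_commutes] at h
    exact h
  have hx2 : x * x = (t : QuaternionAlgebra K a' 0 b') * x - 1 := by
    rw [eq_sub_iff_add_eq, ← hmul]
    abel
  -- (4) the recursion at exponent `n = m + 1`
  obtain ⟨m, rfl⟩ : ∃ m, n = m + 1 := Nat.exists_eq_succ_of_ne_zero hn.ne'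
  obtain ⟨A, B, hQ, hC⟩ := pow_succ_eq_linear x t hx2 m
  rw [hxn] at hQ
  -- (5) the conjugate bound, embedding by embedding
  intro φ
  by_cases hA : A = 0
  · -- `A = 0`: then `B = 1`, every complex root `z` of `z² = φ(t) z - 1` is an `n`-th root of unity
    have hB : B = 1 := by
      rw [hA, QuaternionAlgebra.coe_zero, zero_mul, zero_add] at hQ
      exact QuaternionAlgebra.coe_injective (by rw [← hQ, QuaternionAlgebra.coe_one])
    obtain ⟨z, hz⟩ := exists_root_quadratic (φ t)
    have hzn : z ^ (m + 1) = 1 := by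
      rw [hC φ z hz, hA, hB, map_zero, map_one, zero_mul, zero_add]
    have ht : ‖φ t‖ ≤ 2 := norm_le_two_of_root_of_unity (Nat.succ_ne_zero m) hzn hz
    have h2 : φ t = 2 * φ x.re := by
      rw [htdef, map_mul, map_ofNat]
    rw [h2, norm_mul, Complex.norm_ofNat] at ht
    linarith
  · -- `A ≠ 0`: then `u = A⁻¹ (1 - B)` is a scalar of norm one, so `u = ±1`
    have hscal : x = ((A⁻¹ * (1 - B) : K) : QuaternionAlgebra K a' 0 b') := by
      have h1 : (A : QuaternionAlgebra K a' 0 b') * x = ((1 - B : K) : QuaternionAlgebra K a' 0 b') := by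
        rw [QuaternionAlgebra.coe_sub, QuaternionAlgebra.coe_one, hQ, add_sub_cancel_right]
      calc x = ((A⁻¹ * A : K) : QuaternionAlgebra K a' 0 b') * x := by
            rw [inv_mul_cancel₀ hA, QuaternionAlgebra.coe_one, one_mul]
        _ = ((A⁻¹ : K) : QuaternionAlgebra K a' 0 b') * ((A : QuaternionAlgebra K a' 0 b') * x) := by
            rw [QuaternionAlgebra.coe_mul, mul_assoc]
        _ = ((A⁻¹ * (1 - B) : K) : QuaternionAlgebra K a' 0 b') := by
            rw [h1, QuaternionAlgebra.coe_mul]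
    set k : K := A⁻¹ * (1 - B) with hkdef
    have hk : k * k = 1 := by
      have h := hnorm
      rw [hscal, QuaternionAlgebra.star_coe, ← QuaternionAlgebra.coe_mul] at h
      exact QuaternionAlgebra.coe_injective (by rw [h, QuaternionAlgebra.coe_one])
    have hre1 : x.re = k := by
      rw [hscal, QuaternionAlgebra.re_coe]
    rcases mul_self_eq_one_iff.mp hk with h1 | h1
    · rw [hre1, h1, map_one, norm_one]
    · rw [hre1, h1, map_neg, map_one, norm_neg, norm_one]

end Summit.Langlands.Langlands.Theorems.TorsionKudlaMillsonWindowTorsionTraceFinite
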